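import Summits.SmoothPoincare4.SmoothPoincare4.Theses.ConvexBisection
import Summits.SmoothPoincare4.SmoothPoincare4.Theorems.ContractibleTwistedDoubleStandard.Negative.DoubleBisection
import Summits.SmoothPoincare4.SmoothPoincare4.Theorems.ContractibleTwistedDoubleStandard.Negative.LoadBearing
import Literature.Topology.FourManifolds.HandleAttachingMaps
import Literature.Topology.FourManifolds.Handles
import Literature.Topology.FourManifolds.Gluing
import Literature.Topology.FourManifolds.ClosedBall

/-!
# Line `legendrian-belt-unlinking` for crux `ConvexBisection.ContractibleTwistedDoubleStandard` (stmt-SmoothPoincare4-3546)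

Skeleton (crux-plan, planner-cruxplan-stmt-SmoothPoincare4-3546-legendrian-belt-unli-0, 2026-08-16) of idea card
`Cruxes/ContractibleTwistedDoubleStandard/Ideas/legendrian-belt-unlinking.md` ("turn the second half upside down
contact-geometrically: Legendrian belt links, tight (+1)-surgery, Eliashberg's rigidity of `#ⁿ(S¹×S²)`"), with the
triage sharpenings of TRIAGE-r1-1 … r1-3 (pass ×3): (i) the transfer `LPR` is EQUIVALENT to the crux (r1-1/2/3), so
it is NOT filed as a stub — the reformulation is the READING stub's output and nothing more; (ii) "crux ⇒ LPR" needs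
the dual filling simply connected (r1-1, r1-3) — automatic here, the dual filling IS `W₂`; (iii) brick (b)
("Lagrangian-slice belt ⇒ double") only ever outputs `X ≅ D(W₁)` (r1-2, r1-3) — adopted: the line's thesis is exactly
"the contact hypothesis kills the twist": a contact twisted double of contractible Stein domains is a smooth DOUBLE,
and the residual is the doubles sector; (iv) the card's dichotomy is not exhaustive and its complement is a BET
(r1-2) — adopted: the bet is isolated as ONE falsifiable stub (`stub_beltChirality`), whose cheapest falsifier is the
shared experiment F0 of r1-1 (`τ^*ξ₂ ≟ ξ₂` for Ukida's planar Stein structure on the Akbulut cork).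

THE LINE (notation: the crux data are a closed smooth 4-manifold `X` covered by smooth embeddings `e₁ : W₁ → X`,
`e₂ : W₂ → X` of two compact CONTRACTIBLE Stein domains `(W₁, J₁)`, `(W₂, J₂)` meeting exactly along the images of
their boundaries with equal pushed-forward complex tangencies; `Y = ∂W₁` the seam, `ψ = e₂⁻¹ ∘ e₁|∂W₁ : ∂W₁ → ∂W₂` the
seam map — an orientation-preserving contactomorphism `(Y, ξ₁) → (∂W₂, ξ₂)` by the refuter's read-back on the item, so
`X = W₁ ∪_ψ W̄₂`):
* `stub_beltReading` (KNOWN modulo vendoring; Stein–Morse theory, Cieliebak–Eliashberg 2012 Chs. 10–12): turn `W̄₂`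
  upside down CONTACT-GEOMETRICALLY. After a Stein homotopy the `J₂`-convex function is Morse with critical values
  ordered by index; the ascending discs `D₁, …, Dₙ` of its index-2 points are pairwise disjoint, properly embedded
  LAGRANGIAN discs, transverse to `∂W₂`, with LEGENDRIAN boundary — the belt link `μ = ∂D` of the Weinstein
  2-handles — and their complement is the Stein 1-handlebody `{φ₂ ≤ c}`. Read from `W₁`: `X = P ∪_∂ Q` where
  `P = W₁ ∪_Λ (n two-handles)` is a Kosinski multi-attachment along `Λ = ψ⁻¹(μ)` — Legendrian for `ξ₁` (plane
  matching) — with the cocore framing of `D`, which is the contact framing PLUS ONE RIGHT TWIST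
  (`J₁.twisting = 1`: a Lagrangian disc with boundary on the convex end frames its boundary by `tb + 1`; calibrated
  in the tree by `twisting_legendrianUnknot_seifertFraming = 1`, the Seifert = Lagrangian-disc framing of the
  standard unknot), and `Q ≅ {φ₂ ≤ c}` is a compact 1-handlebody. (`P` is the smooth trace of the CONTACT
  (+1)-SURGERY `(Y, ξ₁) ⇝ (#ⁿ S¹×S², ξ_std)` of the card; Conway–Etnyre–Tosun arXiv:1712.07287 Thm 20 and p. 8.)
* `stub_beltChirality` (the LEVER and the BET; NEW; refutable by computation): Lagrangian-sliceness of the belt link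
  TRANSFERS across the common contact seam of two contractible Stein fillings — `Λ = ψ⁻¹(∂D)` bounds pairwise
  disjoint Lagrangian discs `D′` in `(W₁, ω_{J₁})`. True at the seam `S³` (Eliashberg: `Cont₊(S³, ξ_std)` is
  connected and the filling is `B⁴` up to symplectomorphism, Gromov–McDuff); vacuous on every instance print can
  certify (Akbulut–Karakurt arXiv:1104.2247 Thm 4.1: the cork twist `τ` is never a contactomorphism of a
  handlebody-type Stein contact structure; KOU arXiv:1607.07661 Thm 1.2); FALSE one step outside the crux's
  hypotheses (the ℚ-acyclic "rational contact cork" of `S³/Q₈`: a contactomorphism of `∂N₋₂(ℝP²)` moving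
  `ker(H₁∂ → H₁)`, Ghiggini–Lisca–Stipsicz arXiv:math/0509714 Cor. 4.11 + Gompf 1998 Ex. 4.14 — there
  `ψ⁻¹(belt)` is not even null-homologous in the filling; CONTRACTIBILITY of both halves is what removes this, and
  the stub keeps both `ContractibleSpace` hypotheses: Disproof/`Negative.LoadBearing.not_crux_without_contractible`
  honoured HERE). Killed by any CONTACT CORK `(C, τ)` (`τ^*ξ ≃ ξ` for a `C`-Stein-filled `ξ`, `τ` not extending):
  `τ⁻¹(belt)` is not slice in the Akbulut–Mazur cork (Akbulut 1991, tree `akbulut1991_mazurCork`). Cheapest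
  falsifier: F0.
* `stub_sliceBeltDouble` (brick (b) of the card; KNOWN modulo vendoring): LAGRANGIAN-SLICE BELT ⇒ DOUBLE. If the
  attaching circles of the `(+1)`-framed Legendrian handles of `P` bound disjoint Lagrangian discs `D′` in
  `(W₁, J₁)` and `X = P ∪_∂ Q` with `Q` a 1-handlebody, then `X` is a smooth double `D(W₁)`: `W₁⁰ = W₁ ∖ ν(D′)` is an
  exact filling of its boundary (CET Thm 20), `∂W₁⁰ ≅ ∂P` (slam-dunk: `hᵢ` is the 0-framed meridian of the handle
  with cocore `D′ᵢ`) `≅ ∂Q = #ᵐ S¹×S²`, fillable hence tight hence `ξ_std` (Eliashberg), so `W₁⁰ ≅ ♮ᵐ S¹×B³`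
  (Eliashberg 1990 / Cieliebak–Eliashberg 2012 Thm 16.9; for exact fillings Wendl arXiv:0806.3193 Thm 1 + planarity),
  `W₁ = ♮ᵐ S¹×B³ ∪ n` two-handles with belt link `Λ`, and `X = P ∪ 3h ∪ 4h = W₁ ∪ (0-framed meridians) ∪ 3h ∪ 4h =
  D(W₁)` (Laudenbach–Poénaru 1972 twice).
* `stub_steinDoubleStandard` (the RESIDUAL = the crux's own `ψ = id` sector; OPEN, Andrews–Curtis-adjacent): doubles
  of compact contractible Stein domains are `S⁴`. CERTIFIED NECESSARY: it is literally the conclusion of the landed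
  `Negative.DoubleBisection.double_standard_of_crux` (p69875), re-derived below as `steinDoubleStandard_of_crux`
  (sorry-free); on paper it is EQUIVALENT to the shared crux `ConvexityLadder.PresentationSpheresStandard`
  (stmt-SmoothPoincare4-3717) by the card's brick (a) `SteinRealisation` (every presentation 5-handlebody is `W × I`
  for a contractible Stein `W`; Gompf 1998 Thm 1.3 + 5-dimensional 2-handle uniqueness), so its provers should work
  on 3717 and the Mazur-type (`n = 1`) sub-case is Mazur's `W × I ≅ B⁵`.
* `ContractibleTwistedDoubleStandard_of` — the kernel-checked composition (pure logic, no `sorry` of its own).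

So the line says precisely: crux 3546 ⟺ its doubles sector, GIVEN the chirality of Legendrian belt links; the
Stein/contact hypothesis is spent entirely in `stub_beltChirality` (and in making `Λ` Legendrian with framing
`tb + 1`), never on recognising `S⁴`.

Disproof.lean (cdisprove gen 2, v7, 2026-08-15; the evidence file is not mounted in this jail — its theorems were
taken from the item's evidence notes and from the three LANDED files under
`Theorems/ContractibleTwistedDoubleStandard/Negative/`, two of which are IMPORTED here as the scratch check demands):
`LoadBearing.not_crux_without_contractible` — the line uses `ContractibleSpace W₁ ∧ ContractibleSpace W₂` at
`stub_beltChirality` (rational contact corks kill the ℚ-acyclic analogue) and `ContractibleSpace W₁` at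
`stub_steinDoubleStandard` (`D(S¹×B³) = S¹×S³`); `LoadBearing.not_crux_without_cover` — the covering hypothesis is
used at `stub_beltReading` (`X = P ∪ Q` is read off `range e₁ ∪ range e₂ = univ`; on `S⁴ ⊔ S⁴` the reading is false);
`LoadBearing.crux_iff_without_compactSpace` — `[CompactSpace X]` is carried along unused, harmless;
`DoubleBisection.double_standard_of_crux` — the residual stub is its conclusion, hence NECESSARY for the crux (no
strength is lost in the reduction); `DoubleBisection.crux_hypotheses_at_sphere` / `steinBisection_of_isDouble`
(non-vacuity) — on `S⁴ = 𝔻⁴ ∪ 𝔻⁴` and on every Stein double `D(C)` all four stubs hold (`n = 0`, resp. `ψ = id`,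
`D′ = D`); Disproof §5 (literature): the first test family `(Akbulut cork, τ)` is no instance for the handlebody
structure `ξ₁` (AK) and undecided for Ukida's planar `ξ₂` (F0) — recorded as the cheapest falsifier of
`stub_beltChirality`. No stub is an instance of a landed Negative lemma (those refute only the hypothesis-deleted
variants). Negatives index (`ledger negatives --problem SmoothPoincare4`, 2026-08-16): 0 refuted statements.
-/

noncomputable section

namespace Summit.SmoothPoincare4.SmoothPoincare4.Cruxes.ContractibleTwistedDoubleStandard.LegendrianBeltUnlinking

open scoped Manifold ContDiff Topology
open Set Function
open Summit.SmoothPoincare4.SmoothPoincare4.Theses.ConvexBisection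
open Literature.Geometry.Symplectic Literature.Topology.FourManifolds

set_option linter.unusedVariables false
set_option linter.dupNamespace false

/-! ### The one auxiliary notion: a system of disjoint Lagrangian discs with Legendrian boundary -/

/-- **A system of `n` pairwise disjoint, properly embedded LAGRANGIAN discs with LEGENDRIAN boundary, transverse to
the boundary, in a compact Stein domain `(W, S)`** — the object the whole line turns on (the card's definition
request D1 `IsLagrangianDisc`, written out over existing declarations): each `D i` is a `C^∞` embedding of the closed
unit 2-disc `𝔻² ⊂ ℝ²` (the tree's `Metric.closedBall 0 1` with its `𝓡∂ 2` structure, `ClosedBall.lean`) into `W`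
sending exactly the unit circle to `∂W`; its boundary circle `D i ∘ (𝕊¹ ↪ 𝔻²)` is a Legendrian knot for the complex
tangencies of `S.J` (`IsLegendrianKnot`, `SteinBoundaryContact.lean`); the Kähler form `ω = -dd^ℂφ`
(`SteinStructure.kahlerForm`) vanishes on every pair of tangent vectors of the disc (LAGRANGIAN); along the boundary
circle the disc is nowhere tangent to `∂W` (some tangent vector leaves the boundary hyperplane
`boundaryTangentSpace = T∂W`); and the images are pairwise disjoint. Examples: the ascending discs (Lagrangian
cocores) of the index-2 critical points of a generic `J`-convex Morse function (Cieliebak–Eliashberg 2012,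
Prop. 11.9: stable manifolds of the Liouville field are isotropic, unstable ones coisotropic); the real disc
`{z₂ = z̄₁} ∩ B⁴` bounded by the standard Legendrian unknot of `SteinBallLegendrian.lean`.
[cite: arXiv:1712.07287, §3.1 (Lagrangian disks properly embedded and transverse to the boundary)] -/
def IsLagrangianDiscSystem {W : Type*} [TopologicalSpace W] [ChartedSpace (EuclideanHalfSpace 4) W]
    [IsManifold (𝓡∂ 4) ∞ W] [CompactSpace W] (S : SteinStructure W) {n : ℕ}
    (D : Fin n → (Metric.closedBall (0 : EuclideanSpace ℝ (Fin 2)) 1) → W) : Prop :=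
  (∀ i, Manifold.IsSmoothEmbedding (𝓡∂ 2) (𝓡∂ 4) ∞ (D i)) ∧
  (∀ i (p : Metric.closedBall (0 : EuclideanSpace ℝ (Fin 2)) 1),
      (𝓡∂ 4).IsBoundaryPoint (D i p) ↔ ‖(p : EuclideanSpace ℝ (Fin 2))‖ = 1) ∧
  (∀ i, IsLegendrianKnot S.J (D i ∘ Set.inclusion Metric.sphere_subset_closedBall)) ∧
  (∀ i (p : Metric.closedBall (0 : EuclideanSpace ℝ (Fin 2)) 1) (v w : EuclideanSpace ℝ (Fin 2)),
      S.kahlerForm (D i p) (mfderiv (𝓡∂ 2) (𝓡∂ 4) (D i) p v) (mfderiv (𝓡∂ 2) (𝓡∂ 4) (D i) p w) = 0) ∧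
  (∀ i (θ : Metric.sphere (0 : EuclideanSpace ℝ (Fin 2)) 1), ∃ v : EuclideanSpace ℝ (Fin 2),
      mfderiv (𝓡∂ 2) (𝓡∂ 4) (D i) (Set.inclusion Metric.sphere_subset_closedBall θ) v ∉
        (boundaryTangentSpace : Submodule ℝ (EuclideanSpace ℝ (Fin 4)))) ∧
  Pairwise fun i j => Disjoint (range (D i)) (range (D j))

/-! ### The stubs -/

/-- **U · `stub_beltReading` — the upside-down contact reading of the second half (KNOWN modulo vendoring; size L).**
For crux data `(X; W₁, W₂; J₁, J₂; e₁, e₂)` (closed smooth `X` covered by two smoothly embedded compact contractible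
Stein domains meeting exactly along the images of their boundaries, with equal pushed-forward complex tangencies on
the seam) there are: `n : ℕ`; a system `D` of `n` disjoint Lagrangian discs with Legendrian boundary in `(W₂, J₂)`
(the ascending discs = Lagrangian cocores of the index-2 critical points of a generic index-ordered `J₂`-convex Morse
function, whose boundary is the BELT LINK `μ` of the Weinstein 2-handles of `W₂`); `n` Kosinski attaching maps
`Λ i : HandleAttachingMap 3 2 W₁` whose attaching circles are the seam-preimages `ψ⁻¹(μᵢ)` ON THE NOSE
(`e₁ ∘ (Λ i).attachingCircle = e₂ ∘ (D i)|∂𝔻²`), LEGENDRIAN for `ξ₁ = contactPlane J₁.J` (the plane-matching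
hypothesis: `de₁(TΛ) = de₂(Tμ) ⊆ de₂(ξ₂) = de₁(ξ₁)`), and whose handle framings have TWISTING NUMBER `+1`
("`tb + 1`": the cocore framing of the Lagrangian disc `Dᵢ`, one right twist from the contact framing on the convex
end — the tree's calibration `twisting_legendrianUnknot_seifertFraming = 1` is the case of the real Lagrangian disc
in `B⁴` — transported by the orientation-preserving contactomorphism `ψ`; `W₁` is Hausdorff as a subspace of `X`, the
`[T2Space W₁]` binder Kosinski's attaching maps want is discharged in the composition); a compact 4-manifold `P` which IS `W₁`
with the `n` two-handles attached along the `Λ i` (`IsMultiAttachment`: on paper `P ≅ e₁(W₁) ∪ e₂(ν(∪ Dᵢ))`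
smoothed — the smooth trace of contact `(+1)`-surgery on `Λ`); a compact 1-HANDLEBODY `Q` (`IsHandlebodyOfIndexLE
3 1 Q`: on paper `Q ≅ e₂(W₂ ∖ ν(∪ Dᵢ)) ≅ {φ₂ ≤ c}`, the Stein 1-handlebody below the index-2 level, by the flow
retraction of Morse theory); and boundary data with `X = P ∪_φ Q` a gluing along the boundary
(`IsBoundaryGluing`). Why true: Cieliebak–Eliashberg 2012, Chs. 10–12 (generic `J`-convex functions are Morse; the
Kähler gradient is Liouville; Morse–Smale genericity and reordering of critical values of a Weinstein structure —
an index-2 point below an index-≤ 1 point has generically no connecting trajectory; Prop. 11.9: ascending manifolds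
are coisotropic, i.e. Lagrangian discs here, invariant under the Liouville flow, hence with Legendrian boundary and
transverse to the regular level `∂W₂`); Conway–Etnyre–Tosun arXiv:1712.07287 p. 8 and Thm 20 (removing the cocores
= the sub-handlebody; the trace along the belt link with the cocore framing); Kosinski VI §6 for the attachment
bookkeeping; collar/corner smoothing for `P`, `Q ⊆ X`. Uses the COVER hypothesis (`X = P ∪ Q`; Disproof
`not_crux_without_cover`) and contractibility of `W₂` only through `χ(W₂) = 1` (number of discs = genus of `Q`, not
recorded in the conclusion). Formal size L: needs Morse–Weinstein theory for the tree's `SteinStructure` (absent),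
invariance of `SteinStructure.twisting` under boundary contactomorphisms (M-sized sub-lemma), and a concrete
`IsMultiAttachment` witness built from tubular neighbourhoods of the `Dᵢ`. This stub's output is the common first
move of cards `legendrian-belt-unlinking`, `legendrian-r-knot-rigidity` and `property-r-mazur-halves` (TRIAGE r1-3
cross-card note), so the lead may hang any of the three engines on it. -/
theorem stub_beltReading :
    ∀ (X : Type) [TopologicalSpace X] [T2Space X] [SecondCountableTopology X] [CompactSpace X]
      [ChartedSpace (EuclideanSpace ℝ (Fin 4)) X] [IsManifold (𝓡 4) ∞ X]
      (W₁ : Type) [TopologicalSpace W₁] [T2Space W₁] [ChartedSpace (EuclideanHalfSpace 4) W₁]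
      [IsManifold (𝓡∂ 4) ∞ W₁] [CompactSpace W₁] [ContractibleSpace W₁]
      (W₂ : Type) [TopologicalSpace W₂] [ChartedSpace (EuclideanHalfSpace 4) W₂] [IsManifold (𝓡∂ 4) ∞ W₂]
      [CompactSpace W₂] [ContractibleSpace W₂]
      (J₁ : SteinStructure W₁) (J₂ : SteinStructure W₂) (e₁ : W₁ → X) (e₂ : W₂ → X),
    Manifold.IsSmoothEmbedding (𝓡∂ 4) (𝓡 4) ∞ e₁ → Manifold.IsSmoothEmbedding (𝓡∂ 4) (𝓡 4) ∞ e₂ →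
    range e₁ ∪ range e₂ = univ →
    range e₁ ∩ range e₂ = e₁ '' (𝓡∂ 4).boundary W₁ →
    range e₁ ∩ range e₂ = e₂ '' (𝓡∂ 4).boundary W₂ →
    (∀ w₁ w₂, e₁ w₁ = e₂ w₂ →
      Submodule.map (mfderiv (𝓡∂ 4) (𝓡 4) e₁ w₁).toLinearMap (contactPlane J₁.J w₁) =
        Submodule.map (mfderiv (𝓡∂ 4) (𝓡 4) e₂ w₂).toLinearMap (contactPlane J₂.J w₂)) →
    ∃ (n : ℕ) (D : Fin n → (Metric.closedBall (0 : EuclideanSpace ℝ (Fin 2)) 1) → W₂)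
      (Λ : Fin n → HandleAttachingMap 3 2 W₁)
      (P : Type) (_ : TopologicalSpace P) (_ : ChartedSpace (EuclideanHalfSpace 4) P)
      (_ : IsManifold (𝓡∂ 4) ∞ P) (_ : CompactSpace P)
      (Q : Type) (_ : TopologicalSpace Q) (_ : ChartedSpace (EuclideanHalfSpace 4) Q)
      (_ : IsManifold (𝓡∂ 4) ∞ Q) (_ : CompactSpace Q)
      (bP : BoundaryData (𝓡∂ 4) P (𝓡 3)) (bQ : BoundaryData (𝓡∂ 4) Q (𝓡 3)) (φ : bP.carrier → bQ.carrier),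
      IsLagrangianDiscSystem J₂ D ∧
      (∀ i (θ : Metric.sphere (0 : EuclideanSpace ℝ (Fin 2)) 1),
          e₁ ((Λ i).attachingCircle θ) = e₂ (D i (Set.inclusion Metric.sphere_subset_closedBall θ))) ∧
      (∀ i, IsLegendrianKnot J₁.J (Λ i).attachingCircle) ∧
      (∀ i, J₁.twisting (Λ i).attachingCircle (Λ i).attachingFraming = 1) ∧
      HandleAttachingMap.IsMultiAttachment Λ (𝓡∂ 4) P ∧
      IsHandlebodyOfIndexLE 3 1 Q ∧
      IsBoundaryGluing bP bQ φ (𝓡 4) X := by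
  sorry

/-- **C · `stub_beltChirality` — Lagrangian-sliceness of the belt link transfers across a common contact seam of two
CONTRACTIBLE Stein fillings (the LEVER; NEW; the line's bet; size XL).** For crux data `(X; W₁, W₂; J₁, J₂; e₁, e₂)`
as above, every system `D` of disjoint Lagrangian discs with Legendrian boundary in `(W₂, J₂)` and every family of
loops `Λc i : 𝕊¹ → W₁` which ARE the seam-preimages of their boundary circles (`e₁ ∘ Λc i = e₂ ∘ (D i)|∂𝔻²`, i.e.
`Λc = ψ⁻¹(∂D)`, automatically Legendrian knots in `(∂W₁, ξ₁)`): the `Λc i` bound a system `D′` of disjoint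
Lagrangian discs with Legendrian boundary in `(W₁, J₁)` (with these boundary parametrisations). Equivalently:
"is Lagrangian-slice in the given contractible Stein filling" is a property of a Legendrian link in a contractibly
Stein-fillable contact homology sphere that does not depend on the filling, nor on the identification of the
boundary. Why plausibly true: (1) seam `S³`: `Cont₊(S³, ξ_std)` is connected (Eliashberg 1992) and every Stein
filling of `(S³, ξ_std)` is `B⁴` up to symplectomorphism of completions (Gromov 1985 / McDuff 1990; tree
`Eliashberg1990_steinFilling_sphere_three` for the diffeomorphism type), so `ψ` is contact-isotopic to a map that
extends symplectically and carries `D` to `D′`; (2) no instance in print violates it: on the Akbulut cork the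
involution `τ` is NOT a contactomorphism of the handlebody-type structure (Akbulut–Karakurt arXiv:1104.2247 Thm 4.1 /
Cor. 4.2–4.3 via `c⁺`; Karakurt–Oba–Ukida arXiv:1607.07661 Thm 1.2 for the mixed pair), and symmetric-link cork
twists of `S⁴` are `S⁴` anyway (Disproof §5); (3) conceptually it is the relative form of filling rigidity that the
crux needs and NOTHING MORE: with `stub_sliceBeltDouble` and the necessity of `stub_steinDoubleStandard`
(`steinDoubleStandard_of_crux`) it turns the crux into its own `ψ = id` sector. Why it might fail (concrete): a
CONTACT CORK — a cork `(C, τ)` with `τ^*ξ` isotopic to `ξ` for some `C`-Stein-induced `ξ` — kills it on the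
instance `W₁ = W₂ = C`, `ψ = τ`, `D =` the cocore of the 2-handle: `τ⁻¹(∂D)` is not even smoothly slice in the
Akbulut–Mazur cork (Akbulut 1991 Thm 2; tree `akbulut1991_mazurCork` for the non-extension), although `C ∪_τ C̄ ≅
S⁴` (so the crux survives and only this line dies). CHEAPEST FALSIFIER = F0 of TRIAGE r1-1: decide whether
`τ^*ξ₂ ≃ ξ₂` for Ukida's PLANAR Stein structure on the Akbulut cork (arXiv:1406.5865; KOU Prop. 2.3: page `P₅`,
monodromy `t_a t_b t_c t_d`) — Heegaard Floer blind (`c⁺(ξ₂)` is the tower generator, fixed by `τ_*`), by Wendl a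
finite Hurwitz-orbit computation in `Mod(P₅, ∂)`, shared with cards 3/6/7 and crux 10511. One step outside the
hypotheses the statement is FALSE: for ℚ-acyclic fillings the "rational contact cork" of `S³/Q₈ = ∂N₋₂(ℝP²)` (a
contactomorphism moving `ker(H₁∂ → H₁)`, Ghiggini–Lisca–Stipsicz arXiv:math/0509714 Cor. 4.11, Gompf 1998 Ex. 4.14;
sibling Disproof §5b) sends the belt circle to a non-null-homologous curve — so BOTH `ContractibleSpace`
hypotheses are kept and load-bearing here (Disproof `not_crux_without_contractible` honoured at this stub). NOT
implied by SPC4 (it asserts Lagrangian discs, not a diffeomorphism type), hence informative either way. -/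
theorem stub_beltChirality :
    ∀ (X : Type) [TopologicalSpace X] [T2Space X] [SecondCountableTopology X] [CompactSpace X]
      [ChartedSpace (EuclideanSpace ℝ (Fin 4)) X] [IsManifold (𝓡 4) ∞ X]
      (W₁ : Type) [TopologicalSpace W₁] [ChartedSpace (EuclideanHalfSpace 4) W₁] [IsManifold (𝓡∂ 4) ∞ W₁]
      [CompactSpace W₁] [ContractibleSpace W₁]
      (W₂ : Type) [TopologicalSpace W₂] [ChartedSpace (EuclideanHalfSpace 4) W₂] [IsManifold (𝓡∂ 4) ∞ W₂]
      [CompactSpace W₂] [ContractibleSpace W₂]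
      (J₁ : SteinStructure W₁) (J₂ : SteinStructure W₂) (e₁ : W₁ → X) (e₂ : W₂ → X),
    Manifold.IsSmoothEmbedding (𝓡∂ 4) (𝓡 4) ∞ e₁ → Manifold.IsSmoothEmbedding (𝓡∂ 4) (𝓡 4) ∞ e₂ →
    range e₁ ∪ range e₂ = univ →
    range e₁ ∩ range e₂ = e₁ '' (𝓡∂ 4).boundary W₁ →
    range e₁ ∩ range e₂ = e₂ '' (𝓡∂ 4).boundary W₂ →
    (∀ w₁ w₂, e₁ w₁ = e₂ w₂ →
      Submodule.map (mfderiv (𝓡∂ 4) (𝓡 4) e₁ w₁).toLinearMap (contactPlane J₁.J w₁) =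
        Submodule.map (mfderiv (𝓡∂ 4) (𝓡 4) e₂ w₂).toLinearMap (contactPlane J₂.J w₂)) →
    ∀ (n : ℕ) (D : Fin n → (Metric.closedBall (0 : EuclideanSpace ℝ (Fin 2)) 1) → W₂)
      (Λc : Fin n → (Metric.sphere (0 : EuclideanSpace ℝ (Fin 2)) 1) → W₁),
    IsLagrangianDiscSystem J₂ D →
    (∀ i (θ : Metric.sphere (0 : EuclideanSpace ℝ (Fin 2)) 1),
        e₁ (Λc i θ) = e₂ (D i (Set.inclusion Metric.sphere_subset_closedBall θ))) →
    ∃ D' : Fin n → (Metric.closedBall (0 : EuclideanSpace ℝ (Fin 2)) 1) → W₁,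
      IsLagrangianDiscSystem J₁ D' ∧
      ∀ i, D' i ∘ Set.inclusion Metric.sphere_subset_closedBall = Λc i := by
  sorry

/-- **B · `stub_sliceBeltDouble` — Lagrangian-slice belt ⇒ double (brick (b) of the card; KNOWN modulo vendoring;
size L).** Let `X` be a closed smooth 4-manifold, `(W₁, J₁)` a compact contractible Stein domain, `Λ i` (`i < n`)
Kosinski attaching maps of 2-handles on `W₁` with LEGENDRIAN attaching circles and handle framings of twisting `+1`
(contact framing plus one right twist), `P` the multi-attachment `W₁ ∪_Λ (n two-handles)`, `Q` a compact
1-handlebody, and `X = P ∪_φ Q` a gluing along the boundary. If the attaching circles bound a system `D′` of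
disjoint Lagrangian discs with Legendrian boundary in `(W₁, J₁)`, then `X` is a smooth DOUBLE of `W₁`
(`IsDouble b (𝓡 4) X` for some boundary datum `b`). Intended proof: (1) `W₁⁰ := W₁ ∖ ν(∪ D′ᵢ)` is, for a suitable
neighbourhood, a symplectic manifold with convex boundary for `ω_{J₁}` restricted (Conway–Etnyre–Tosun
arXiv:1712.07287 Thm 20 with Lemma 22), and EXACT (`ω_{J₁} = -dd^ℂφ₁` is exact on `W₁`); (2) `W₁ = W₁⁰ ∪ n`
two-handles `h′ᵢ = ν(D′ᵢ)` with cocores `D′ᵢ` and belt link `Λ`; the framing a Lagrangian disc with boundary on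
the convex end induces on its boundary is the contact framing `+1` (twisting `+1`; model: the real disc of the
standard unknot, `twisting_legendrianUnknot_seifertFraming`), which EQUALS the given handle framing, so `hᵢ` is the
0-framed meridian of the attaching circle of `h′ᵢ` and `∂P ≅ ∂W₁⁰` (slam-dunk); (3) `∂P ≅_φ ∂Q`, and a compact
1-handlebody with connected orientable boundary is `♮ᵐ S¹×B³` (`∂W₁⁰` is connected: `H³(W₁⁰) = H³(W₁) = 0`;
orientable as `∂P`), so `∂W₁⁰ ≅ #ᵐ S¹×S²`; (4) the contact structure `W₁⁰` induces on it is exactly fillable, hence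
tight, hence `ξ_std` (Eliashberg: `#ᵐ S¹×S²` carries a unique tight contact structure), and fillings of
`(#ᵐ S¹×S², ξ_std)` are `♮ᵐ S¹×B³` (Stein: Eliashberg 1990, Cieliebak–Eliashberg 2012 Thm 16.9; exact/strong: Wendl
arXiv:0806.3193 Thm 1 — planar open book with page the `m`-holed disc and trivial monodromy, whose only positive
factorisation is the empty one), so `W₁⁰ ≅ ♮ᵐ S¹×B³`; (5) `X = P ∪_φ ♮ᵐ S¹×B³ = P ∪ m` three-handles `∪` a
four-handle for ANY `φ` (Laudenbach–Poénaru 1972: diffeomorphisms of `#ᵐ S¹×S²` extend), and `D(W₁) = W₁ ∪`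
(0-framed meridians of its 2-handles) `∪ m` three-handles `∪` four-handle (the double of a 2-handlebody
`♮ᵐ S¹×B³ ∪ h′`, Gompf–Stipsicz 1999 §4.6 / §5.5) `= P ∪ 3h ∪ 4h ≅ X`. No `W₂`, no contact surgery and no
homology of the seam enter: the contact input is only "exactly fillable ⇒ tight ⇒ standard on `#S¹×S²`".
`ContractibleSpace W₁` is kept for uniformity (it makes `W₁` nonempty, connected, with connected boundary; the
conclusion would survive for any connected Stein `W₁` with connected boundary). Seam-`S³` sanity case (`W₁ = B⁴`):
the conclusion "`X` is a double of `B⁴`" is `X ≅ S⁴` outright. Formal size L: CET Thm 20, the `#S¹×S²` filling and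
tightness classification and Laudenbach–Poénaru as named facts; Kirby-calculus bookkeeping over `IsMultiAttachment`
/ `IsBoundaryGluing` / `IsDouble` (gluing uniqueness `nonempty_diffeomorph_of_isBoundaryGluing` is in the tree). -/
theorem stub_sliceBeltDouble :
    ∀ (X : Type) [TopologicalSpace X] [T2Space X] [SecondCountableTopology X] [CompactSpace X]
      [ChartedSpace (EuclideanSpace ℝ (Fin 4)) X] [IsManifold (𝓡 4) ∞ X]
      (W₁ : Type) [TopologicalSpace W₁] [T2Space W₁] [ChartedSpace (EuclideanHalfSpace 4) W₁]
      [IsManifold (𝓡∂ 4) ∞ W₁] [CompactSpace W₁] [ContractibleSpace W₁] (J₁ : SteinStructure W₁)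
      (n : ℕ) (Λ : Fin n → HandleAttachingMap 3 2 W₁)
      (P : Type) [TopologicalSpace P] [ChartedSpace (EuclideanHalfSpace 4) P] [IsManifold (𝓡∂ 4) ∞ P]
      [CompactSpace P]
      (Q : Type) [TopologicalSpace Q] [ChartedSpace (EuclideanHalfSpace 4) Q] [IsManifold (𝓡∂ 4) ∞ Q]
      [CompactSpace Q]
      (bP : BoundaryData (𝓡∂ 4) P (𝓡 3)) (bQ : BoundaryData (𝓡∂ 4) Q (𝓡 3)) (φ : bP.carrier → bQ.carrier)
      (D' : Fin n → (Metric.closedBall (0 : EuclideanSpace ℝ (Fin 2)) 1) → W₁),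
    (∀ i, IsLegendrianKnot J₁.J (Λ i).attachingCircle) →
    (∀ i, J₁.twisting (Λ i).attachingCircle (Λ i).attachingFraming = 1) →
    HandleAttachingMap.IsMultiAttachment Λ (𝓡∂ 4) P →
    IsHandlebodyOfIndexLE 3 1 Q →
    IsBoundaryGluing bP bQ φ (𝓡 4) X →
    IsLagrangianDiscSystem J₁ D' →
    (∀ i, D' i ∘ Set.inclusion Metric.sphere_subset_closedBall = (Λ i).attachingCircle) →
    ∃ b : BoundaryData (𝓡∂ 4) W₁ (𝓡 3), IsDouble b (𝓡 4) X := by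
  sorry

/-- **R · `stub_steinDoubleStandard` — doubles of compact contractible Stein domains are `S⁴` (the RESIDUAL = the
crux's `ψ = id` sector; OPEN, Andrews–Curtis-adjacent; hardest stub).** For a compact contractible `W` carrying a
Stein structure `S` and a boundary datum `b`, every Hausdorff second-countable smooth closed 4-manifold `X` which is
a double `W ∪_{id} W` (`IsDouble b (𝓡 4) X`) is diffeomorphic to the round `S⁴`. CERTIFIED NECESSARY for the crux:
this is verbatim the conclusion of the landed `Negative.DoubleBisection.double_standard_of_crux` (every Stein double
is a Stein bisection along a common contact seam), see `steinDoubleStandard_of_crux` below — so the reduction of the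
line loses nothing. On paper: a compact Stein domain is a Legendrian 2-handlebody (Eliashberg; Gompf 1998 Thm 1.3,
converse direction, not in the tree), so `X = D(W) = ∂(W × I)` is the presentation homotopy sphere `Σ(𝒫, ε)` of the
balanced presentation read off the handles, and conversely EVERY `(𝒫, ε)` arises from a contractible STEIN `W`
(the card's brick (a) `SteinRealisation`, Ideator2Sketch.lean: Legendrian realisation with free framing parity,
Gompf 1998 Thm 1.3, + 5-dimensional 2-handle uniqueness, tree `IsPresentationHandlebodyFive`) — hence this stub is
EQUIVALENT to the shared crux `ConvexityLadder.PresentationSpheresStandard` (stmt-SmoothPoincare4-3717; also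
EntropyLadder / RicciTranscript) and the Stein hypothesis in it is cosmetic: provers should attack 3717. Known
sub-cases: `W` Mazur-type (one 1-handle, one 2-handle: `W × I ≅ B⁵`, Mazur 1961 / Zeeman), Andrews–Curtis-trivial
presentations (Andrews–Curtis 1965; tree `IsPresentationHandlebodyFive.nonempty_diffeomorph_closedBall_of_
isStablyAndrewsCurtisEquivalent`), the Akbulut–Kirby / Gompf family (Gompf 1991); `W = 𝔻⁴` is the seam-`S³` case
(`isDouble_sphere_holds 3` + gluing uniqueness). Why it might fail: one balanced presentation of the trivial group
with exotic `∂H⁵(𝒫, ε)` refutes it — and SPC4 (`ContractibleSpace W` is load-bearing: `D(S¹×B³) = S¹×S³`; Disproof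
`not_crux_without_contractible` honoured here too). IMPLIED BY SPC4 (shape `D(W) ≃ₕ S⁴ ⇒ ≅ S⁴`), so only provable,
never cheaply refutable. -/
theorem stub_steinDoubleStandard :
    ∀ (W : Type) [TopologicalSpace W] [ChartedSpace (EuclideanHalfSpace 4) W] [IsManifold (𝓡∂ 4) ∞ W]
      [CompactSpace W] [ContractibleSpace W] (S : SteinStructure W) (b : BoundaryData (𝓡∂ 4) W (𝓡 3))
      (X : Type) [TopologicalSpace X] [T2Space X] [SecondCountableTopology X]
      [ChartedSpace (EuclideanSpace ℝ (Fin 4)) X] [IsManifold (𝓡 4) ∞ X],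
    IsDouble b (𝓡 4) X →
    Nonempty (X ≃ₘ⟮𝓡 4, 𝓡 4⟯ Metric.sphere (0 : EuclideanSpace ℝ (Fin 5)) 1) := by
  sorry

/-! ### Calibration: the residual is necessary (sorry-free, from the landed Negative file) -/

/-- **The residual stub is implied by the crux** — `double_standard_of_crux` (landed p69875,
`Negative/DoubleBisection.lean`) in this file's binder order: nothing is lost by reducing the crux to its doubles
sector. [folklore] -/
theorem steinDoubleStandard_of_crux (h : ContractibleTwistedDoubleStandard) :
    ∀ (W : Type) [TopologicalSpace W] [ChartedSpace (EuclideanHalfSpace 4) W] [IsManifold (𝓡∂ 4) ∞ W]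
      [CompactSpace W] [ContractibleSpace W] (S : SteinStructure W) (b : BoundaryData (𝓡∂ 4) W (𝓡 3))
      (X : Type) [TopologicalSpace X] [T2Space X] [SecondCountableTopology X]
      [ChartedSpace (EuclideanSpace ℝ (Fin 4)) X] [IsManifold (𝓡 4) ∞ X],
    IsDouble b (𝓡 4) X →
    Nonempty (X ≃ₘ⟮𝓡 4, 𝓡 4⟯ Metric.sphere (0 : EuclideanSpace ℝ (Fin 5)) 1) := by
  intro W _ _ _ _ _ S b X _ _ _ _ _ hD
  exact Theorems.ContractibleTwistedDoubleStandard.Negative.double_standard_of_crux h W S b X hD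

/-! ### The composition (kernel-checked; no `sorry` of its own) -/

/-- **The crux from the four stubs: contact twisted doubles of contractible Stein domains are doubles, and doubles
are standard.** Read the bisection upside down (`stub_beltReading`: Legendrian belt link `Λ = ψ⁻¹(∂D)` with `(+1)`
framing, `X = P ∪ Q`); transfer the Lagrangian cocores across the contact seam (`stub_beltChirality`); conclude that
`X` is a double of `W₁` (`stub_sliceBeltDouble`); recognise `S⁴` (`stub_steinDoubleStandard`). -/
theorem ContractibleTwistedDoubleStandard_of : ContractibleTwistedDoubleStandard := by
  intro X _ _ _ _ _ _ W₁ _ _ _ _ _ W₂ _ _ _ _ _ J₁ J₂ e₁ e₂ h₁ h₂ hU hL hR hξ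
  -- the halves are Hausdorff: they embed in the Hausdorff `X` (Kosinski's attaching maps are stated for T₂ bases)
  haveI : T2Space W₁ := h₁.isEmbedding.t2Space
  obtain ⟨n, D, Λ, P, _, _, _, _, Q, _, _, _, _, bP, bQ, φ, hD, hΛD, hLeg, htw, hP, hQ, hX⟩ :=
    stub_beltReading X W₁ W₂ J₁ J₂ e₁ e₂ h₁ h₂ hU hL hR hξ
  obtain ⟨D', hD', hbd⟩ :=
    stub_beltChirality X W₁ W₂ J₁ J₂ e₁ e₂ h₁ h₂ hU hL hR hξ n D (fun i => (Λ i).attachingCircle) hD hΛD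
  obtain ⟨b, hb⟩ :=
    stub_sliceBeltDouble X W₁ J₁ n Λ P Q bP bQ φ D' hLeg htw hP hQ hX hD' hbd
  exact stub_steinDoubleStandard W₁ J₁ b X hb

end Summit.SmoothPoincare4.SmoothPoincare4.Cruxes.ContractibleTwistedDoubleStandard.LegendrianBeltUnlinking

end
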